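import Summits.AtomisticToContinuum.HydrodynamicLimit.Theses.LambertianContactSwap
import Summits.AtomisticToContinuum.HydrodynamicLimit.Theorems.LambertianContactSwapSwapGapFieldConcentrationOfLD
import Summits.AtomisticToContinuum.HydrodynamicLimit.Theorems.LambertianContactSwapSwapGapEntropyTransfer
import Summits.AtomisticToContinuum.HydrodynamicLimit.Theorems.OneFlightGossipEngineUniformLocalGibbsConcentrationFields
import Literature.MathematicalPhysics.KineticTheory.LambertianHardSphereFlow
import Literature.MathematicalPhysics.KineticTheory.HardSphereEulerProofs
import Literature.Analysis.FunctionSpaces.FlatTorus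
import HarnessLib

/-!
# `SwapGap` (stmt-AtomisticToContinuum-11850), line `Sketch`, stub T5: linear statistics suffice (smooth tests)

Helper file (`--supports stmt-AtomisticToContinuum-11850`) of line `Sketch` (card `entropy-relative-to-lambertian-law`) for the
crux `Summit.AtomisticToContinuum.HydrodynamicLimit.Theses.LambertianContactSwap.SwapGap`, registered stub
`stub_fieldConcentration_smooth_of_linear` (T5) of the lead's skeleton v9 (§10): for test functions `χ` with smooth periodic
lift, the research stub S2 of the line (speed-`N` self-averaging, under `P_N ⊗ γ^ℕ`, of EVERY bounded `1`-Lipschitz statistic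
`F` of the `χ`-tested field triple of the Lambertian gas `Λ_t` about its own mean) follows from speed-`N` self-averaging of the
five LINEAR statistics — the density field `ρ_χ`, the momentum field `m_χ ∈ V3` and the energy field `e_χ` — about their own
means.

Proof: `ℝ × V3 × ℝ` carries the sup (product) metric, so for the mean vector `c_N := (∫ρ_χ∘Λ_t, ∫m_χ∘Λ_t, ∫e_χ∘Λ_t)` and
`1`-Lipschitz `F`, `|F(fld) − F(c_N)| ≤ max(|ρ_χ − c_N.1|, ‖m_χ − c_N.2.1‖, |e_χ − c_N.2.2|)`; the union bound over the three
hypotheses at level `δ` gives `(P_N ⊗ γ^ℕ){δ < |F(fld Λ_t) − F(c_N)|} ≤ 3C e^{−(N+1)/C} ≤ (3C) e^{−(N+1)/(3C)}`, and the landed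
bookkeeping lemma `expConc_sub_integral_of_expConc_sub_const` (p106600; `|F| ≤ 1`, `|F(c_N)| ≤ 1`, `P_N ⊗ γ^ℕ` a probability
measure for `σ ≤ 1/2`, `F ∘ fld ∘ Λ_t` measurable by `measurable_fieldTriple` and `measurable_lambertFlow_hsDiameter` for
`σ < 1/2`) recentres at the mean of `F`; `σ₀ := min (1/2) σ₀'`.  Same structure as `fieldConcentration_of_lambertianEulerLD`
(S2 ⇐ LD, p106600), with the Euler values replaced by the (`N`-dependent) means.

prover-line-stmt-AtomisticToContinuum-11850-c5-0 (wave 6 worker), cycle 6.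
-/

noncomputable section

open MeasureTheory Filter Set Topology
open scoped ENNReal

namespace Summit.AtomisticToContinuum.HydrodynamicLimit.Theorems

open Literature.Analysis.FluidPDE Literature.MathematicalPhysics.KineticTheory
open Summit.AtomisticToContinuum.HydrodynamicLimit.Theses.LambertianContactSwap

/-- **T5 · LINEAR STATISTICS SUFFICE (smooth tests)** (stub `stub_fieldConcentration_smooth_of_linear` of line `Sketch` of the
crux `SwapGap`): for test functions `χ` with smooth periodic lift, S2's speed-`N` self-averaging of EVERY bounded 1-Lipschitz
statistic `F` of the `χ`-tested field triple of `Λ_t` follows from speed-`N` self-averaging of the five LINEAR statistics — the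
density field `ρ_χ`, the momentum field `m_χ ∈ V3` and the energy field `e_χ` — about their own means.  Proof: `ℝ × V3 × ℝ`
carries the sup (product) metric, so for the mean vector `c_N := (∫ρ_χ∘Λ_t, ∫m_χ∘Λ_t, ∫e_χ∘Λ_t)` and 1-Lipschitz `F`,
`|F(fld) − F(c_N)| ≤ max(|ρ_χ − c_N.1|, ‖m_χ − c_N.2.1‖, |e_χ − c_N.2.2|)`; the union bound over the three hypotheses at level `δ`
gives `(P_N ⊗ γ^ℕ){δ < |F(fld Λ_t) − F(c_N)|} ≤ 3C e^{−(N+1)/C}` (absorb `3` into the constant), and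
`expConc_sub_integral_of_expConc_sub_const` (`|F| ≤ 1`, `|F(c_N)| ≤ 1`, `P_N ⊗ γ^ℕ` a probability measure for `σ ≤ 1/2`,
`F ∘ fld ∘ Λ_t` measurable by `measurable_fieldTriple` and `measurable_lambertFlow_hsDiameter`) recentres at the mean of `F`;
`σ₀ := min (1/2) σ₀'`. [folklore] -/
theorem stub_fieldConcentration_smooth_of_linear
    (hlin :
    ∀ (a₀ θ₀ : T3 → ℝ) (u₀ : T3 → V3), Continuous a₀ → Continuous θ₀ → Continuous u₀ →
      (∀ x, 0 < a₀ x) → (∀ x, 0 < θ₀ x) →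
      ∃ σ₀ : ℝ, 0 < σ₀ ∧ ∀ σ : ℝ, 0 < σ → σ < σ₀ →
        ∀ (T : ℝ) (ρ θ : ℝ → T3 → ℝ) (u : ℝ → T3 → V3), IsHardSphereEulerSolution σ T ρ u θ →
          ∀ Φ : (N : ℕ) → HardSphereFlow (Torus.geometry (Fin 3)) (hsDiameter σ N) (N + 1),
            TendstoHydroFieldsAt (fun N => localGibbsLaw σ a₀ u₀ θ₀ N (Φ N)) Φ ρ u θ 0 →
              ∀ t ∈ Set.Ico 0 T, ∀ χ : T3 → ℝ, Literature.Analysis.FunctionSpaces.Torus.IsSmooth χ → ∀ δ : ℝ, 0 < δ →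
                ∃ C : ℝ, 0 < C ∧ ∀ N : ℕ,
                  ((localGibbsLaw σ a₀ u₀ θ₀ N (Φ N)).prod (lambertNoise (Fin 3)))
                      {p | δ < |empiricalDensityField
                          (lambertFlow (Torus.geometry (Fin 3)) (hsDiameter σ N) p.2 p.1 t) χ -
                        ∫ q, empiricalDensityField
                          (lambertFlow (Torus.geometry (Fin 3)) (hsDiameter σ N) q.2 q.1 t) χ
                          ∂((localGibbsLaw σ a₀ u₀ θ₀ N (Φ N)).prod (lambertNoise (Fin 3)))|} ≤
                    ENNReal.ofReal (C * Real.exp (-(C⁻¹ * ((N : ℝ) + 1)))) ∧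
                  ((localGibbsLaw σ a₀ u₀ θ₀ N (Φ N)).prod (lambertNoise (Fin 3)))
                      {p | δ < ‖empiricalMomentumField
                          (lambertFlow (Torus.geometry (Fin 3)) (hsDiameter σ N) p.2 p.1 t) χ -
                        ∫ q, empiricalMomentumField
                          (lambertFlow (Torus.geometry (Fin 3)) (hsDiameter σ N) q.2 q.1 t) χ
                          ∂((localGibbsLaw σ a₀ u₀ θ₀ N (Φ N)).prod (lambertNoise (Fin 3)))‖} ≤
                    ENNReal.ofReal (C * Real.exp (-(C⁻¹ * ((N : ℝ) + 1)))) ∧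
                  ((localGibbsLaw σ a₀ u₀ θ₀ N (Φ N)).prod (lambertNoise (Fin 3)))
                      {p | δ < |empiricalEnergyField
                          (lambertFlow (Torus.geometry (Fin 3)) (hsDiameter σ N) p.2 p.1 t) χ -
                        ∫ q, empiricalEnergyField
                          (lambertFlow (Torus.geometry (Fin 3)) (hsDiameter σ N) q.2 q.1 t) χ
                          ∂((localGibbsLaw σ a₀ u₀ θ₀ N (Φ N)).prod (lambertNoise (Fin 3)))|} ≤
                    ENNReal.ofReal (C * Real.exp (-(C⁻¹ * ((N : ℝ) + 1))))) :
    ∀ (a₀ θ₀ : T3 → ℝ) (u₀ : T3 → V3), Continuous a₀ → Continuous θ₀ → Continuous u₀ →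
      (∀ x, 0 < a₀ x) → (∀ x, 0 < θ₀ x) →
      ∃ σ₀ : ℝ, 0 < σ₀ ∧ ∀ σ : ℝ, 0 < σ → σ < σ₀ →
        ∀ (T : ℝ) (ρ θ : ℝ → T3 → ℝ) (u : ℝ → T3 → V3), IsHardSphereEulerSolution σ T ρ u θ →
          ∀ Φ : (N : ℕ) → HardSphereFlow (Torus.geometry (Fin 3)) (hsDiameter σ N) (N + 1),
            TendstoHydroFieldsAt (fun N => localGibbsLaw σ a₀ u₀ θ₀ N (Φ N)) Φ ρ u θ 0 →
              ∀ t ∈ Set.Ico 0 T, ∀ χ : T3 → ℝ, Literature.Analysis.FunctionSpaces.Torus.IsSmooth χ →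
                ∀ F : ℝ × V3 × ℝ → ℝ, LipschitzWith 1 F → (∀ y, |F y| ≤ 1) → ∀ δ : ℝ, 0 < δ →
                  ∃ C : ℝ, 0 < C ∧ ∀ N : ℕ,
                    ((localGibbsLaw σ a₀ u₀ θ₀ N (Φ N)).prod (lambertNoise (Fin 3)))
                      {p | δ < |F (empiricalDensityField
                              (lambertFlow (Torus.geometry (Fin 3)) (hsDiameter σ N) p.2 p.1 t) χ,
                            empiricalMomentumField
                              (lambertFlow (Torus.geometry (Fin 3)) (hsDiameter σ N) p.2 p.1 t) χ,
                            empiricalEnergyField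
                              (lambertFlow (Torus.geometry (Fin 3)) (hsDiameter σ N) p.2 p.1 t) χ) -
                          ∫ q, F (empiricalDensityField
                              (lambertFlow (Torus.geometry (Fin 3)) (hsDiameter σ N) q.2 q.1 t) χ,
                            empiricalMomentumField
                              (lambertFlow (Torus.geometry (Fin 3)) (hsDiameter σ N) q.2 q.1 t) χ,
                            empiricalEnergyField
                              (lambertFlow (Torus.geometry (Fin 3)) (hsDiameter σ N) q.2 q.1 t) χ)
                            ∂((localGibbsLaw σ a₀ u₀ θ₀ N (Φ N)).prod (lambertNoise (Fin 3)))|} ≤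
                      ENNReal.ofReal (C * Real.exp (-(C⁻¹ * ((N : ℝ) + 1)))) := by
  intro a₀ θ₀ u₀ ha hθ hu ha0 hθ0
  obtain ⟨σ₁, hσ₁, h1⟩ := hlin a₀ θ₀ u₀ ha hθ hu ha0 hθ0
  refine ⟨min 2⁻¹ σ₁, lt_min (by norm_num) hσ₁, ?_⟩
  intro σ hσ hσlt T ρ θ u hE Φ h0 t ht χ hχ F hF hF1 δ hδ
  have hσhalf : σ < 2⁻¹ := hσlt.trans_le (min_le_left _ _)
  have hσ₁' : σ < σ₁ := hσlt.trans_le (min_le_right _ _)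
  have hχc : Continuous χ := hχ.continuous
  have hlint := h1 σ hσ hσ₁' T ρ θ u hE Φ h0 t ht χ hχ
  -- notation
  set Q : (N : ℕ) → Measure (Config (N + 1) (Fin 3) T3 × (ℕ → EuclideanSpace ℝ (Fin 3))) :=
    fun N => (localGibbsLaw σ a₀ u₀ θ₀ N (Φ N)).prod (lambertNoise (Fin 3)) with hQ
  have hQN : ∀ N, IsProbabilityMeasure (Q N) := fun N => by
    haveI := isProbabilityMeasure_localGibbsLaw ha hθ hu ha0 hθ0 (by linarith) N (Φ N)
    rw [hQ]; infer_instance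
  set X : (N : ℕ) → Config (N + 1) (Fin 3) T3 × (ℕ → EuclideanSpace ℝ (Fin 3)) → ℝ × V3 × ℝ :=
    fun N p => (empiricalDensityField (lambertFlow (Torus.geometry (Fin 3)) (hsDiameter σ N) p.2 p.1 t) χ,
      empiricalMomentumField (lambertFlow (Torus.geometry (Fin 3)) (hsDiameter σ N) p.2 p.1 t) χ,
      empiricalEnergyField (lambertFlow (Torus.geometry (Fin 3)) (hsDiameter σ N) p.2 p.1 t) χ)
    with hX
  -- the (`N`-dependent) centres: the means of the three linear statistics
  set c : ℕ → ℝ × V3 × ℝ := fun N =>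
    (∫ q, empiricalDensityField (lambertFlow (Torus.geometry (Fin 3)) (hsDiameter σ N) q.2 q.1 t) χ ∂Q N,
      ∫ q, empiricalMomentumField (lambertFlow (Torus.geometry (Fin 3)) (hsDiameter σ N) q.2 q.1 t) χ ∂Q N,
      ∫ q, empiricalEnergyField (lambertFlow (Torus.geometry (Fin 3)) (hsDiameter σ N) q.2 q.1 t) χ ∂Q N)
    with hc
  have hXm : ∀ N, Measurable (X N) := fun N =>
    (measurable_fieldTriple hχc).comp (measurable_lambertFlow_hsDiameter hσ.le hσhalf N t)
  -- exponential concentration of `F ∘ X` around the constants `F (c N)`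
  have hconst : ∀ δ' : ℝ, 0 < δ' → ∃ C : ℝ, 0 < C ∧ ∀ N : ℕ,
      Q N {p | δ' < |F (X N p) - F (c N)|} ≤
        ENNReal.ofReal (C * Real.exp (-(C⁻¹ * ((N : ℝ) + 1)))) := by
    intro δ' hδ'
    obtain ⟨C, hC, hCN⟩ := hlint δ' hδ'
    refine ⟨3 * C, by positivity, fun N => ?_⟩
    have hsub : {p | δ' < |F (X N p) - F (c N)|} ⊆
        {p | δ' < |(X N p).1 - (c N).1|} ∪ {p | δ' < ‖(X N p).2.1 - (c N).2.1‖} ∪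
          {p | δ' < |(X N p).2.2 - (c N).2.2|} := by
      intro p hp
      simp only [mem_setOf_eq] at hp
      have hd : δ' < dist (X N p) (c N) := by
        have h1 : dist (F (X N p)) (F (c N)) ≤ dist (X N p) (c N) := by
          simpa using hF.dist_le_mul (X N p) (c N)
        rw [Real.dist_eq] at h1
        exact hp.trans_le h1
      rw [Prod.dist_eq, Prod.dist_eq, Real.dist_eq, dist_eq_norm, Real.dist_eq] at hd
      simp only [mem_union, mem_setOf_eq]
      rcases lt_max_iff.1 hd with h | h
      · exact Or.inl (Or.inl h)
      · rcases lt_max_iff.1 h with h' | h'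
        · exact Or.inl (Or.inr h')
        · exact Or.inr h'
    obtain ⟨hD, hM, hEn⟩ := hCN N
    calc Q N {p | δ' < |F (X N p) - F (c N)|}
        ≤ Q N {p | δ' < |(X N p).1 - (c N).1|} + Q N {p | δ' < ‖(X N p).2.1 - (c N).2.1‖} +
            Q N {p | δ' < |(X N p).2.2 - (c N).2.2|} :=
          (measure_mono hsub).trans
            ((measure_union_le _ _).trans (add_le_add (measure_union_le _ _) le_rfl))
      _ ≤ ENNReal.ofReal (C * Real.exp (-(C⁻¹ * ((N : ℝ) + 1)))) +
            ENNReal.ofReal (C * Real.exp (-(C⁻¹ * ((N : ℝ) + 1)))) +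
            ENNReal.ofReal (C * Real.exp (-(C⁻¹ * ((N : ℝ) + 1)))) :=
          add_le_add (add_le_add hD hM) hEn
      _ = ENNReal.ofReal (3 * (C * Real.exp (-(C⁻¹ * ((N : ℝ) + 1))))) := by
          rw [← ENNReal.ofReal_add (by positivity) (by positivity),
            ← ENNReal.ofReal_add (by positivity) (by positivity)]
          ring_nf
      _ ≤ ENNReal.ofReal (3 * C * Real.exp (-((3 * C)⁻¹ * ((N : ℝ) + 1)))) := by
          refine ENNReal.ofReal_le_ofReal ?_
          rw [mul_assoc]
          refine mul_le_mul_of_nonneg_left (mul_le_mul_of_nonneg_left (Real.exp_le_exp.2 ?_) hC.le)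
            (by norm_num)
          have h3 : (3 * C)⁻¹ ≤ C⁻¹ := inv_anti₀ hC (by linarith)
          have hN : (0 : ℝ) ≤ (N : ℝ) + 1 := by positivity
          nlinarith
  -- around the mean
  have hmain := expConc_sub_integral_of_expConc_sub_const Q hQN (fun N p => F (X N p))
    (fun N => hF.continuous.measurable.comp (hXm N)) (fun N p => hF1 _) (fun N => F (c N))
    (fun N => hF1 (c N)) hconst hδ
  simpa only [hX, hQ] using hmain

end Summit.AtomisticToContinuum.HydrodynamicLimit.Theorems
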